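import Literature.NumberTheory.EllipticCurves.IsogenyCyclicKernelTwelfthPowerProofs
import Mathlib.NumberTheory.Padics.PadicVal.Basic
import HarnessLib

/-!
# `n·v_p(Δ(E)) ≡ v_p(Δ(E')) (mod 12)` along a `ℚ`-isogeny with cyclic kernel of order `n` prime
# to `6` (Dokchitser–Dokchitser 2015, Table 1 / Thm. 6, discriminant row; proofs only)

Topic `NumberTheory/EllipticCurves`; THEOREMS ONLY; the valuation form of
`Isogeny.exists_Δ_pow_eq_mul_pow_twelve` (`IsogenyCyclicKernelTwelfthPowerProofs`:
`Δ(E)ⁿ = Δ(E')·c¹²`, `c ∈ ℚ`): for every prime `p`,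
`n·v_p(Δ(E)) ≡ v_p(Δ(E')) (mod 12)` — for the models at hand (`E` short Weierstrass; minimal
discriminants differ from these by `12`-th powers of the scalings, so the same congruence holds for
`v_p(Δ_min)`). This is the congruence `δ' ≡ pδ (mod 12)` of Dokchitser–Dokchitser 2015, Thm. 6
(deduced there from Thm. 3) for a `p`-isogeny, here for every cyclic kernel of order prime to `6`.

## References
* [DokchitserDokchitser2015LocalInvariants] §3 Thm. 6 (`δ' ≡ pδ mod 12`), §2 Thm. 3.
-/

noncomputable section

open scoped Classical

open Finset

namespace WeierstrassCurve

namespace Isogeny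

open Affine Affine.Point

variable {W W' : WeierstrassCurve ℚ} [W.IsElliptic] [W'.IsElliptic]

/-- **`n·v_p(Δ(E)) ≡ v_p(Δ(E')) (mod 12)`** for a `ℚ`-isogeny `φ : E → E'` of elliptic curves,
`E : y² = x³ + a₄x + a₆`, with cyclic kernel `⟨P⟩` of order `n = 2m + 1` prime to `3`, at every
prime `p` (from `Δ(E)ⁿ = Δ(E')·c¹²`, `c ∈ ℚˣ`). Dokchitser–Dokchitser's congruence
`δ' ≡ pδ (mod 12)` (Thm. 6, from Coates' Thm. 3) for these models.
[cite: DokchitserDokchitser2015LocalInvariants, §3 Thm. 6 (`δ' ≡ pδ mod 12`) from §2 Thm. 3] -/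
theorem padicValRat_Δ_modEq_twelve [W.IsShortNF] (φ : Isogeny W W')
    {x₀ y₀ : AlgebraicClosure ℚ}
    (h : (W⁄(AlgebraicClosure ℚ)).toAffine.Nonsingular x₀ y₀) {n m : ℕ} (hnm : n = 2 * m + 1)
    (h3 : Nat.Coprime 3 n) (h1n : 1 < n) (hn : (n : ℤ) • Point.some x₀ y₀ h = 0)
    (hmin : ∀ k : ℕ, 0 < k → k < n → (k : ℤ) • Point.some x₀ y₀ h ≠ 0)
    (hker : ∀ Q : W.geomPoints, Q ∈ φ.toAddMonoidHom.ker ↔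
      Q ∈ (range n).image fun k : ℕ => (k : ℤ) • Point.some x₀ y₀ h)
    (p : ℕ) [Fact p.Prime] :
    (n : ℤ) * padicValRat p W.Δ ≡ padicValRat p W'.Δ [ZMOD 12] := by
  obtain ⟨c, hc⟩ := φ.exists_Δ_pow_eq_mul_pow_twelve h hnm h3 h1n hn hmin hker
  have hΔ : W.Δ ≠ 0 := W.isUnit_Δ.ne_zero
  have hΔ' : W'.Δ ≠ 0 := W'.isUnit_Δ.ne_zero
  have hc0 : c ≠ 0 := by
    rintro rfl
    rw [zero_pow (by norm_num), mul_zero] at hc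
    exact pow_ne_zero n hΔ hc
  have hv := congrArg (padicValRat p) hc
  rw [padicValRat.pow, padicValRat.mul hΔ' (pow_ne_zero 12 hc0), padicValRat.pow] at hv
  rw [Int.modEq_iff_dvd]
  exact ⟨-padicValRat p c, by push_cast at hv ⊢; linarith⟩

end Isogeny

end WeierstrassCurve
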